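import Mathlib
import HarnessLib
import Summits.AtomisticToContinuum.FouriersLaw.Theorems.JunctionLocalityNonBallisticLightConePropagation
import Summits.AtomisticToContinuum.FouriersLaw.Theorems.JunctionLocalityNonBallisticLightConeKinematics

/-!
# Short-time dipole floor, helper 6: the pathwise local light cone of the common-noise flip

Helper (`--supports stmt-AtomisticToContinuum-11749`) for stub `stub_shortTimeDipoleFloor` (S) of line
`kick-dipole-no-collapse`, crux `JunctionLocality.ConductanceLowerBound`.  Deterministic (pathwise) facts.

Two solutions `z = chainFlow x η`, `z' = chainFlow (x^{i₀}) η` of the Langevin integral equation of the pinned chain driven by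
the SAME continuous noise path, from `x` and from `x` with the momentum of site `i₀` flipped.  Differently from the GLOBAL-box
propagation bound of the tree (`NonBallistic.chainFlow_momentumFlip_propagation`, all positions in `[-R, R]`), the Lipschitz
constants of the cubic nearest-neighbour forces are kept LOCAL: the site deviations `u_k = |δq_k| + |δp_k|` obey

  `u_k(t') ≤ u_k(0) + ĉ_k ∫₀^{t'} Σ_{|l−k|≤1} u_l`,   `ĉ_k = C₁ Σ_{|l−k|≤1} θ̂_l`,   `θ̂_l = 1 + Q_l + Q'_l`,

where `Q_l = 2q_l(0)² + 2t∫₀ᵗ p_l²` (resp. `Q'_l` along `z'`) bounds `q_l(s)²` on `[0,t]` (positions integrate momenta,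
`pinnedChain_chainFlow_position_sq_le`) and `C₁ = 5 + 2γ + ω₂ + 2 lam + 8β` (`volterra_local`).  The coefficients are
time-independent functionals of the two paths whose Gibbs ⊗ Wiener moments are local and `N`-uniform (next helper).
-/

noncomputable section

open MeasureTheory Set Filter Topology Finset

namespace Summit.AtomisticToContinuum.FouriersLaw.Cruxes.ConductanceLowerBound.KickDipoleNoCollapse

open Literature.MathematicalPhysics.KineticTheory.HeatConduction
open Summit.AtomisticToContinuum.FouriersLaw.Theorems.NonBallistic
open Summit.AtomisticToContinuum.FouriersLaw.Theorems.NonBallistic.LightConePropagation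

variable {N : ℕ} {ω₂ lam β γ : ℝ}

/-! ### Local Lipschitz bounds of the cubic forces -/

/-- `|(c₁a + c₃a³) − (c₁b + c₃b³)| ≤ (c₁ + 2c₃)(1 + a² + b²)|a − b|` (`c₁, c₃ ≥ 0`). -/
theorem abs_cubic_sub_cubic_le_local {c₁ c₃ a b : ℝ} (hc₁ : 0 ≤ c₁) (hc₃ : 0 ≤ c₃) :
    |(c₁ * a + c₃ * a ^ 3) - (c₁ * b + c₃ * b ^ 3)| ≤ (c₁ + 2 * c₃) * (1 + a ^ 2 + b ^ 2) * |a - b| := by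
  have hfac : (c₁ * a + c₃ * a ^ 3) - (c₁ * b + c₃ * b ^ 3) = (c₁ + c₃ * (a ^ 2 + a * b + b ^ 2)) * (a - b) := by ring
  rw [hfac, abs_mul]
  refine mul_le_mul_of_nonneg_right ?_ (abs_nonneg _)
  have h0 : 0 ≤ a ^ 2 + a * b + b ^ 2 := by nlinarith [sq_nonneg (a + b), sq_nonneg a, sq_nonneg b]
  rw [abs_of_nonneg (by positivity)]
  nlinarith [sq_nonneg (a - b), sq_nonneg a, sq_nonneg b, mul_nonneg hc₃ (sq_nonneg (a - b)),
    mul_nonneg hc₁ (add_nonneg (sq_nonneg a) (sq_nonneg b))]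

/-- **Local Lipschitz bound of the force of the pinned chain.**  With the site weights `w_j = 1 + q_j² + q'_j²`, a
nonnegative `d` dominating `|q'_j − q_j|`, and the neighbourhood sums `W_i = Σ_{|l−i|≤1} w_l`, `D_i = Σ_{|l−i|≤1} d_l`:
`|∂_iΦ(q') − ∂_iΦ(q)| ≤ (ω₂ + 2 lam + 8(1 + 2β)) W_i D_i`. -/
theorem abs_dPotential_sub_le_local (hω : 0 ≤ ω₂) (hl : 0 ≤ lam) (hβ : 0 ≤ β) (γ : ℝ) (q q' : Fin N → ℝ)
    {d : Fin N → ℝ} (hd0 : ∀ j, 0 ≤ d j) (hd : ∀ j, |q' j - q j| ≤ d j) (i : Fin N) :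
    |(pinnedChain ω₂ lam β γ).dPotential N i q' - (pinnedChain ω₂ lam β γ).dPotential N i q| ≤
      (ω₂ + 2 * lam + 8 * (1 + 2 * β)) *
        (∑ l : Fin N, if l.val ≤ i.val + 1 ∧ i.val ≤ l.val + 1 then (1 + q l ^ 2 + q' l ^ 2) else 0) *
        (∑ l : Fin N, if l.val ≤ i.val + 1 ∧ i.val ≤ l.val + 1 then d l else 0) := by
  set w : Fin N → ℝ := fun l => 1 + q l ^ 2 + q' l ^ 2 with hw
  set W : ℝ := ∑ l : Fin N, if l.val ≤ i.val + 1 ∧ i.val ≤ l.val + 1 then w l else 0 with hW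
  set D : ℝ := ∑ l : Fin N, if l.val ≤ i.val + 1 ∧ i.val ≤ l.val + 1 then d l else 0 with hD
  have hw1 : ∀ l, 1 ≤ w l := fun l => by simp only [hw]; nlinarith [sq_nonneg (q l), sq_nonneg (q' l)]
  have hw0 : ∀ l, 0 ≤ w l := fun l => zero_le_one.trans (hw1 l)
  -- members of the neighbourhood are dominated by the sums
  have hmemW : ∀ l : Fin N, l.val ≤ i.val + 1 ∧ i.val ≤ l.val + 1 → w l ≤ W := by
    intro l hl
    rw [hW]
    have := Finset.single_le_sum (f := fun l : Fin N => if l.val ≤ i.val + 1 ∧ i.val ≤ l.val + 1 then w l else 0)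
      (fun l _ => by split_ifs <;> [exact hw0 l; exact le_rfl]) (Finset.mem_univ l)
    simpa [hl] using this
  have hmemD : ∀ l : Fin N, l.val ≤ i.val + 1 ∧ i.val ≤ l.val + 1 → d l ≤ D := by
    intro l hl
    rw [hD]
    have := Finset.single_le_sum (f := fun l : Fin N => if l.val ≤ i.val + 1 ∧ i.val ≤ l.val + 1 then d l else 0)
      (fun l _ => by split_ifs <;> [exact hd0 l; exact le_rfl]) (Finset.mem_univ l)
    simpa [hl] using this
  have hii : i.val ≤ i.val + 1 ∧ i.val ≤ i.val + 1 := ⟨Nat.le_succ _, Nat.le_succ _⟩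
  have hWi : w i ≤ W := hmemW i hii
  have hW0 : 0 ≤ W := (hw0 i).trans hWi
  have hW1 : 1 ≤ W := (hw1 i).trans hWi
  have hDi : d i ≤ D := hmemD i hii
  have hD0 : 0 ≤ D := (hd0 i).trans hDi
  rw [OscillatorChain.dPotential_eq_closed, OscillatorChain.dPotential_eq_closed]
  simp only [pinnedChain_deriv_U, pinnedChain_deriv_V]
  -- pinning term
  have hU : |(ω₂ * q' i + lam * q' i ^ 3) - (ω₂ * q i + lam * q i ^ 3)| ≤ (ω₂ + 2 * lam) * W * D := by
    refine (abs_cubic_sub_cubic_le_local hω hl).trans ?_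
    have h1 : 1 + q' i ^ 2 + q i ^ 2 = w i := by simp only [hw]; ring
    rw [h1]
    calc (ω₂ + 2 * lam) * w i * |q' i - q i| ≤ (ω₂ + 2 * lam) * W * d i := by
          refine mul_le_mul (mul_le_mul_of_nonneg_left hWi (by positivity)) (hd i) (abs_nonneg _) (by positivity)
      _ ≤ (ω₂ + 2 * lam) * W * D := mul_le_mul_of_nonneg_left hDi (by positivity)
  -- a bond term between neighbours `j, l` of `i` (both in the neighbourhood)
  have hV : ∀ j l : Fin N, j.val ≤ i.val + 1 ∧ i.val ≤ j.val + 1 → l.val ≤ i.val + 1 ∧ i.val ≤ l.val + 1 →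
      |(q' l - q' j + β * (q' l - q' j) ^ 3) - (q l - q j + β * (q l - q j) ^ 3)| ≤ 4 * (1 + 2 * β) * W * D := by
    intro j l hj hl'
    have h := abs_cubic_sub_cubic_le_local (c₁ := 1) (c₃ := β) (a := q' l - q' j) (b := q l - q j) zero_le_one hβ
    rw [one_mul, one_mul] at h
    refine h.trans ?_
    have hr : 1 + (q' l - q' j) ^ 2 + (q l - q j) ^ 2 ≤ 4 * W := by
      have h2 : 1 + (q' l - q' j) ^ 2 + (q l - q j) ^ 2 ≤ 2 * (w j + w l) := by
        simp only [hw]; nlinarith [sq_nonneg (q' l + q' j), sq_nonneg (q l + q j)]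
      linarith [hmemW j hj, hmemW l hl']
    have hdd : |q' l - q' j - (q l - q j)| ≤ D := by
      by_cases hjl : j = l
      · subst hjl; simp [hD0]
      · calc |q' l - q' j - (q l - q j)| = |(q' l - q l) - (q' j - q j)| := by ring_nf
          _ ≤ |q' l - q l| + |q' j - q j| := abs_sub _ _
          _ ≤ d l + d j := add_le_add (hd l) (hd j)
          _ ≤ D := by
              rw [hD, ← Finset.sum_filter]
              have hsub : ({l, j} : Finset (Fin N)) ⊆ univ.filter (fun m : Fin N => m.val ≤ i.val + 1 ∧ i.val ≤ m.val + 1) := by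
                intro m hm
                simp only [Finset.mem_insert, Finset.mem_singleton] at hm
                rcases hm with rfl | rfl <;> simp [hl', hj]
              calc d l + d j = ∑ m ∈ ({l, j} : Finset (Fin N)), d m := by
                    rw [Finset.sum_pair (Ne.symm hjl)]
                _ ≤ _ := Finset.sum_le_sum_of_subset_of_nonneg hsub fun m _ _ => hd0 m
    calc (1 + 2 * β) * (1 + (q' l - q' j) ^ 2 + (q l - q j) ^ 2) * |q' l - q' j - (q l - q j)|
        ≤ (1 + 2 * β) * (4 * W) * D := by
          refine mul_le_mul (mul_le_mul_of_nonneg_left hr (by positivity)) hdd (abs_nonneg _) (by positivity)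
      _ = 4 * (1 + 2 * β) * W * D := by ring
  -- left bond
  have hL : |(if h : 0 < i.val then q' i - q' ⟨i.val - 1, by omega⟩ + β * (q' i - q' ⟨i.val - 1, by omega⟩) ^ 3
        else 0) -
      (if h : 0 < i.val then q i - q ⟨i.val - 1, by omega⟩ + β * (q i - q ⟨i.val - 1, by omega⟩) ^ 3
        else 0)| ≤ 4 * (1 + 2 * β) * W * D := by
    by_cases h : 0 < i.val
    · rw [dif_pos h, dif_pos h]
      exact hV ⟨i.val - 1, by omega⟩ i ⟨by simp; omega, by simp; omega⟩ hii
    · rw [dif_neg h, dif_neg h, sub_zero, abs_zero]; positivity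
  -- right bond
  have hRb : |(if h : i.val + 1 < N then q' ⟨i.val + 1, h⟩ - q' i + β * (q' ⟨i.val + 1, h⟩ - q' i) ^ 3
        else 0) -
      (if h : i.val + 1 < N then q ⟨i.val + 1, h⟩ - q i + β * (q ⟨i.val + 1, h⟩ - q i) ^ 3
        else 0)| ≤ 4 * (1 + 2 * β) * W * D := by
    by_cases h : i.val + 1 < N
    · rw [dif_pos h, dif_pos h]
      exact hV i ⟨i.val + 1, h⟩ hii ⟨by show i.val + 1 ≤ i.val + 1; omega, by show i.val ≤ i.val + 1 + 1; omega⟩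
    · rw [dif_neg h, dif_neg h, sub_zero, abs_zero]; positivity
  -- combine
  have key : ∀ (u u' v v' w w' : ℝ), (u' + v' - w') - (u + v - w) = (u' - u) + (v' - v) - (w' - w) := by
    intros; ring
  rw [key]
  refine (abs_sub _ _).trans ((add_le_add ((abs_add_le _ _).trans (add_le_add hU hL)) hRb).trans ?_)
  nlinarith [mul_nonneg hW0 hD0]

/-- **Local Lipschitz bound for the momentum drift**: with `d` dominating the position AND momentum differences,
`|Y(z')_{p,i} − Y(z)_{p,i}| ≤ (ω₂ + 2lam + 8(1+2β)) W_i D_i + 2γ d_i`. -/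
theorem abs_drift_snd_sub_le_local (hω : 0 ≤ ω₂) (hl : 0 ≤ lam) (hβ : 0 ≤ β) (hγ : 0 ≤ γ) (z z' : PhaseSpace N)
    {d : Fin N → ℝ} (hd0 : ∀ j, 0 ≤ d j) (hd1 : ∀ j, |z'.1 j - z.1 j| ≤ d j) (hd2 : ∀ j, |z'.2 j - z.2 j| ≤ d j)
    (i : Fin N) :
    |((pinnedChain ω₂ lam β γ).drift N z').2 i - ((pinnedChain ω₂ lam β γ).drift N z).2 i| ≤
      (ω₂ + 2 * lam + 8 * (1 + 2 * β)) *
        (∑ l : Fin N, if l.val ≤ i.val + 1 ∧ i.val ≤ l.val + 1 then (1 + z.1 l ^ 2 + z'.1 l ^ 2) else 0) *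
        (∑ l : Fin N, if l.val ≤ i.val + 1 ∧ i.val ≤ l.val + 1 then d l else 0) + 2 * γ * d i := by
  rw [pinnedChain_drift_apply, pinnedChain_drift_apply]
  dsimp only
  have hF := abs_dPotential_sub_le_local hω hl hβ γ z.1 z'.1 hd0 hd1 i
  have hw0 := bathWeight_nonneg N i
  have hw2 := bathWeight_le_two N i
  have hfr : |γ * OscillatorChain.bathWeight N i * z'.2 i - γ * OscillatorChain.bathWeight N i * z.2 i| ≤
      2 * γ * d i := by
    rw [← mul_sub, abs_mul, abs_of_nonneg (mul_nonneg hγ hw0)]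
    calc γ * OscillatorChain.bathWeight N i * |z'.2 i - z.2 i| ≤ γ * 2 * d i :=
          mul_le_mul (mul_le_mul_of_nonneg_left hw2 hγ) (hd2 i) (abs_nonneg _) (by positivity)
      _ = 2 * γ * d i := by ring
  have key : ∀ F F' f f' : ℝ, (-F' - f') - (-F - f) = -((F' - F) + (f' - f)) := by intros; ring
  rw [key, abs_neg]
  exact (abs_add_le _ _).trans (add_le_add hF hfr)

/-! ### The local Volterra inequality of the common-noise flip -/

section Flow

variable (hω : 0 < ω₂) (hl : 0 ≤ lam) (hβ : 0 ≤ β) (hγ : 0 ≤ γ) (N : ℕ) (i₀ : Fin N) (x : PhaseSpace N)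
  {η : ℝ → Fin N → ℝ} (hη : Continuous η) {t : ℝ} (ht : 0 ≤ t)
include hω hl hβ hγ hη ht

/-- **The local Volterra inequality.**  For the flows `z = chainFlow x η`, `z' = chainFlow (x^{i₀}) η` of the pinned chain
driven by the same continuous noise path, the site deviations `u_k(s) = |δq_k(s)| + |δp_k(s)|` are continuous, nonnegative,
vanish at time `0` off `i₀` where `u_{i₀}(0) = 2|p_{i₀}|`, and on `[0, t]`
`u_k(t') ≤ u_k(0) + C₁ Θ_k ∫₀^{t'} Σ_{|l−k|≤1} u_l`, `C₁ = 1 + 2γ + ω₂ + 2 lam + 8(1+2β)`, `Θ_k = Σ_{|l−k|≤1} θ_l ≥ 1`,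
`θ_l = 1 + (2q_l(0)² + 2t∫₀ᵗ p_l²) + (2q_l(0)² + 2t∫₀ᵗ p'_l²)`. -/
theorem volterra_local :
    (∀ k : Fin N, Continuous fun s =>
      |((pinnedChain ω₂ lam β γ).chainFlow N (momentumFlip i₀ x) η s).1 k - ((pinnedChain ω₂ lam β γ).chainFlow N x η s).1 k| +
      |((pinnedChain ω₂ lam β γ).chainFlow N (momentumFlip i₀ x) η s).2 k - ((pinnedChain ω₂ lam β γ).chainFlow N x η s).2 k|) ∧
    (∀ k : Fin N, k ≠ i₀ →
      |((pinnedChain ω₂ lam β γ).chainFlow N (momentumFlip i₀ x) η 0).1 k - ((pinnedChain ω₂ lam β γ).chainFlow N x η 0).1 k| +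
      |((pinnedChain ω₂ lam β γ).chainFlow N (momentumFlip i₀ x) η 0).2 k - ((pinnedChain ω₂ lam β γ).chainFlow N x η 0).2 k| = 0) ∧
    (|((pinnedChain ω₂ lam β γ).chainFlow N (momentumFlip i₀ x) η 0).1 i₀ - ((pinnedChain ω₂ lam β γ).chainFlow N x η 0).1 i₀| +
      |((pinnedChain ω₂ lam β γ).chainFlow N (momentumFlip i₀ x) η 0).2 i₀ - ((pinnedChain ω₂ lam β γ).chainFlow N x η 0).2 i₀| =
        2 * |x.2 i₀|) ∧
    (∀ k : Fin N, 1 ≤ ∑ l : Fin N, if l.val ≤ k.val + 1 ∧ k.val ≤ l.val + 1 then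
        (1 + (2 * x.1 l ^ 2 + 2 * t * ∫ r in (0:ℝ)..t, ((pinnedChain ω₂ lam β γ).chainFlow N x η r).2 l ^ 2) +
          (2 * x.1 l ^ 2 + 2 * t * ∫ r in (0:ℝ)..t, ((pinnedChain ω₂ lam β γ).chainFlow N (momentumFlip i₀ x) η r).2 l ^ 2))
        else 0) ∧
    (∀ k : Fin N, ∀ t' ∈ Set.Icc 0 t,
      |((pinnedChain ω₂ lam β γ).chainFlow N (momentumFlip i₀ x) η t').1 k - ((pinnedChain ω₂ lam β γ).chainFlow N x η t').1 k| +
      |((pinnedChain ω₂ lam β γ).chainFlow N (momentumFlip i₀ x) η t').2 k - ((pinnedChain ω₂ lam β γ).chainFlow N x η t').2 k| ≤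
      (|((pinnedChain ω₂ lam β γ).chainFlow N (momentumFlip i₀ x) η 0).1 k - ((pinnedChain ω₂ lam β γ).chainFlow N x η 0).1 k| +
        |((pinnedChain ω₂ lam β γ).chainFlow N (momentumFlip i₀ x) η 0).2 k - ((pinnedChain ω₂ lam β γ).chainFlow N x η 0).2 k|) +
      ((1 + 2 * γ + (ω₂ + 2 * lam + 8 * (1 + 2 * β))) *
        ∑ l : Fin N, if l.val ≤ k.val + 1 ∧ k.val ≤ l.val + 1 then
          (1 + (2 * x.1 l ^ 2 + 2 * t * ∫ r in (0:ℝ)..t, ((pinnedChain ω₂ lam β γ).chainFlow N x η r).2 l ^ 2) +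
            (2 * x.1 l ^ 2 + 2 * t * ∫ r in (0:ℝ)..t, ((pinnedChain ω₂ lam β γ).chainFlow N (momentumFlip i₀ x) η r).2 l ^ 2))
          else 0) *
      ∫ s in (0:ℝ)..t', ∑ l : Fin N, if l.val ≤ k.val + 1 ∧ k.val ≤ l.val + 1 then
        (|((pinnedChain ω₂ lam β γ).chainFlow N (momentumFlip i₀ x) η s).1 l - ((pinnedChain ω₂ lam β γ).chainFlow N x η s).1 l| +
          |((pinnedChain ω₂ lam β γ).chainFlow N (momentumFlip i₀ x) η s).2 l - ((pinnedChain ω₂ lam β γ).chainFlow N x η s).2 l|)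
        else 0) := by
  set P := pinnedChain ω₂ lam β γ with hP
  set z : ℝ → PhaseSpace N := P.chainFlow N x η with hz
  set z' : ℝ → PhaseSpace N := P.chainFlow N (momentumFlip i₀ x) η with hz'
  set u : Fin N → ℝ → ℝ := fun k s => |(z' s).1 k - (z s).1 k| + |(z' s).2 k - (z s).2 k| with hu
  set θ : Fin N → ℝ := fun l => 1 + (2 * x.1 l ^ 2 + 2 * t * ∫ r in (0:ℝ)..t, (z r).2 l ^ 2) +
    (2 * x.1 l ^ 2 + 2 * t * ∫ r in (0:ℝ)..t, (z' r).2 l ^ 2) with hθ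
  set Θ : Fin N → ℝ := fun k => ∑ l : Fin N, if l.val ≤ k.val + 1 ∧ k.val ≤ l.val + 1 then θ l else 0 with hΘ
  set K : ℝ := ω₂ + 2 * lam + 8 * (1 + 2 * β) with hK
  set D : Fin N → ℝ → ℝ := fun k s => ∑ l : Fin N, if l.val ≤ k.val + 1 ∧ k.val ≤ l.val + 1 then u l s else 0 with hD
  have hK0 : 0 ≤ K := by positivity
  -- continuity
  have hzc : Continuous z := pinnedChain_continuous_chainFlow hω hl hβ hγ N x hη
  have hz'c : Continuous z' := pinnedChain_continuous_chainFlow hω hl hβ hγ N (momentumFlip i₀ x) hη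
  have hcoord : ∀ k, (Continuous fun s => (z s).1 k) ∧ (Continuous fun s => (z s).2 k) ∧
      (Continuous fun s => (z' s).1 k) ∧ (Continuous fun s => (z' s).2 k) := fun k =>
    ⟨(continuous_apply k).comp (continuous_fst.comp hzc), (continuous_apply k).comp (continuous_snd.comp hzc),
      (continuous_apply k).comp (continuous_fst.comp hz'c), (continuous_apply k).comp (continuous_snd.comp hz'c)⟩
  have huc : ∀ k, Continuous (u k) := fun k => by
    obtain ⟨h1, h2, h3, h4⟩ := hcoord k
    exact ((h3.sub h1).abs).add ((h4.sub h2).abs)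
  have hu0 : ∀ k s, 0 ≤ u k s := fun k s => add_nonneg (abs_nonneg _) (abs_nonneg _)
  have hDc : ∀ k, Continuous (D k) := fun k =>
    continuous_finsetSum _ fun l _ => by split_ifs <;> [exact huc l; exact continuous_const]
  have hD0 : ∀ k s, 0 ≤ D k s := fun k s => Finset.sum_nonneg fun l _ => by split_ifs <;> [exact hu0 l s; exact le_rfl]
  have huD : ∀ k s, u k s ≤ D k s := fun k s => by
    have := Finset.single_le_sum (f := fun l : Fin N => if l.val ≤ k.val + 1 ∧ k.val ≤ l.val + 1 then u l s else 0)
      (fun l _ => by split_ifs <;> [exact hu0 l s; exact le_rfl]) (Finset.mem_univ k)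
    simpa [hD] using this
  -- initial data
  have hz0 : z 0 = x + ((0 : Fin N → ℝ), η 0) := pinnedChain_chainFlow_of_nonpos ω₂ lam β γ N x hη le_rfl
  have hz'0 : z' 0 = momentumFlip i₀ x + ((0 : Fin N → ℝ), η 0) :=
    pinnedChain_chainFlow_of_nonpos ω₂ lam β γ N (momentumFlip i₀ x) hη le_rfl
  have hu_init : ∀ k, u k 0 = if k = i₀ then 2 * |x.2 i₀| else 0 := by
    intro k
    simp only [hu, hz0, hz'0, Prod.fst_add, Prod.snd_add, Pi.add_apply, momentumFlip_fst, sub_self,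
      abs_zero, zero_add, add_sub_add_right_eq_sub]
    by_cases hk : k = i₀
    · subst hk
      rw [if_pos rfl, momentumFlip_snd_self, show -x.2 k - x.2 k = -(2 * x.2 k) by ring, abs_neg, abs_mul, abs_two]
    · rw [if_neg hk, momentumFlip_snd_of_ne hk, sub_self, abs_zero]
  -- kinematic position bounds on `[0, t]`
  have hθ1 : ∀ l, 1 ≤ θ l := by
    intro l
    have h1 : 0 ≤ ∫ r in (0:ℝ)..t, (z r).2 l ^ 2 := intervalIntegral.integral_nonneg ht fun r _ => sq_nonneg _
    have h2 : 0 ≤ ∫ r in (0:ℝ)..t, (z' r).2 l ^ 2 := intervalIntegral.integral_nonneg ht fun r _ => sq_nonneg _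
    simp only [hθ]
    nlinarith [sq_nonneg (x.1 l)]
  have hθ0 : ∀ l, 0 ≤ θ l := fun l => zero_le_one.trans (hθ1 l)
  have hΘ1 : ∀ k, 1 ≤ Θ k := by
    intro k
    have := Finset.single_le_sum (f := fun l : Fin N => if l.val ≤ k.val + 1 ∧ k.val ≤ l.val + 1 then θ l else 0)
      (fun l _ => by split_ifs <;> [exact hθ0 l; exact le_rfl]) (Finset.mem_univ k)
    have hkk : k.val ≤ k.val + 1 ∧ k.val ≤ k.val + 1 := ⟨Nat.le_succ _, Nat.le_succ _⟩
    simp only [hkk, and_self, if_true] at this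
    exact (hθ1 k).trans this
  have hwθ : ∀ s ∈ Set.Icc 0 t, ∀ l, 1 + (z s).1 l ^ 2 + (z' s).1 l ^ 2 ≤ θ l := by
    intro s hs l
    have h1 := (pinnedChain_chainFlow_position_sq_le ω₂ lam β γ hω hl hβ hγ N x η hη t s hs l).2
    have h2 := (pinnedChain_chainFlow_position_sq_le ω₂ lam β γ hω hl hβ hγ N (momentumFlip i₀ x) η hη t s hs l).2
    rw [momentumFlip_fst] at h2
    simp only [hθ]
    linarith
  have hWΘ : ∀ s ∈ Set.Icc 0 t, ∀ k,
      (∑ l : Fin N, if l.val ≤ k.val + 1 ∧ k.val ≤ l.val + 1 then (1 + (z s).1 l ^ 2 + (z' s).1 l ^ 2) else 0) ≤ Θ k := by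
    intro s hs k
    refine Finset.sum_le_sum fun l _ => ?_
    split_ifs
    · exact hwθ s hs l
    · exact le_rfl
  refine ⟨huc, fun k hk => ?_, ?_, hΘ1, ?_⟩
  · have h := hu_init k
    rw [if_neg hk] at h
    exact h
  · have h := hu_init i₀
    rw [if_pos rfl] at h
    exact h
  -- the integral inequality
  intro k t' ht'
  have ht'0 : 0 ≤ t' := ht'.1
  obtain ⟨hq, hp⟩ := pinnedChain_chainFlow_sub_apply hω hl hβ hγ N x (momentumFlip i₀ x) hη k ht'0
  have hδ0 : (z' 0).1 k - (z 0).1 k = (momentumFlip i₀ x).1 k - x.1 k ∧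
      (z' 0).2 k - (z 0).2 k = (momentumFlip i₀ x).2 k - x.2 k := by
    rw [hz0, hz'0]
    simp only [Prod.fst_add, Prod.snd_add, Pi.add_apply, Pi.zero_apply, add_zero, add_sub_add_right_eq_sub,
      and_self]
  have hYc : Continuous fun s => (P.drift N (z' s)).2 k - (P.drift N (z s)).2 k :=
    (pinnedChain_continuous_chainFlow_apply hω hl hβ hγ N (momentumFlip i₀ x) hη k).2.2.sub
      (pinnedChain_continuous_chainFlow_apply hω hl hβ hγ N x hη k).2.2
  -- positions
  have h1 : |(z' t').1 k - (z t').1 k| ≤ |(z' 0).1 k - (z 0).1 k| + ∫ s in (0:ℝ)..t', D k s := by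
    have hbd : |∫ s in (0:ℝ)..t', ((z' s).2 k - (z s).2 k)| ≤ ∫ s in (0:ℝ)..t', D k s := by
      refine (intervalIntegral.abs_integral_le_integral_abs ht'0).trans ?_
      refine intervalIntegral.integral_mono_on ht'0 ?_ ((hDc k).intervalIntegrable _ _) fun s _ => ?_
      · obtain ⟨-, h2, -, h4⟩ := hcoord k
        exact ((h4.sub h2).abs).intervalIntegrable _ _
      · exact le_trans (le_add_of_nonneg_left (abs_nonneg _)) (huD k s)
    have e : (z' t').1 k - (z t').1 k = ((z' 0).1 k - (z 0).1 k) + ∫ s in (0:ℝ)..t', ((z' s).2 k - (z s).2 k) := by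
      rw [hδ0.1]; exact hq
    rw [e]
    exact (abs_add_le _ _).trans (by linarith)
  -- momenta
  have h2 : |(z' t').2 k - (z t').2 k| ≤ |(z' 0).2 k - (z 0).2 k| + (K * Θ k + 2 * γ) * ∫ s in (0:ℝ)..t', D k s := by
    have hbd : |∫ s in (0:ℝ)..t', ((P.drift N (z' s)).2 k - (P.drift N (z s)).2 k)| ≤
        ∫ s in (0:ℝ)..t', (K * Θ k + 2 * γ) * D k s := by
      refine (intervalIntegral.abs_integral_le_integral_abs ht'0).trans ?_
      refine intervalIntegral.integral_mono_on ht'0 (hYc.abs.intervalIntegrable _ _)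
        (((hDc k).const_mul _).intervalIntegrable _ _) fun s hs => ?_
      have hst : s ∈ Set.Icc 0 t := ⟨hs.1, hs.2.trans ht'.2⟩
      have hF := abs_drift_snd_sub_le_local hω.le hl hβ hγ (z s) (z' s) (d := fun l => u l s) (fun l => hu0 l s)
        (fun l => le_add_of_nonneg_right (abs_nonneg _)) (fun l => le_add_of_nonneg_left (abs_nonneg _)) k
      refine hF.trans ?_
      have hWk := hWΘ s hst k
      have hDk := hD0 k s
      have huk := huD k s
      show K * (∑ l : Fin N, if l.val ≤ k.val + 1 ∧ k.val ≤ l.val + 1 then (1 + (z s).1 l ^ 2 + (z' s).1 l ^ 2) else 0) * D k s +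
        2 * γ * u k s ≤ (K * Θ k + 2 * γ) * D k s
      nlinarith [mul_nonneg hK0 hDk]
    rw [intervalIntegral.integral_const_mul] at hbd
    have e : (z' t').2 k - (z t').2 k = ((z' 0).2 k - (z 0).2 k) +
        ∫ s in (0:ℝ)..t', ((P.drift N (z' s)).2 k - (P.drift N (z s)).2 k) := by
      rw [hδ0.2]; exact hp
    rw [e]
    exact (abs_add_le _ _).trans (by linarith)
  -- combine
  have hI0 : 0 ≤ ∫ s in (0:ℝ)..t', D k s := intervalIntegral.integral_nonneg ht'0 fun s _ => hD0 k s
  have hΘk := hΘ1 k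
  show u k t' ≤ u k 0 + (1 + 2 * γ + K) * Θ k * ∫ s in (0:ℝ)..t', D k s
  calc u k t' = |(z' t').1 k - (z t').1 k| + |(z' t').2 k - (z t').2 k| := rfl
    _ ≤ (|(z' 0).1 k - (z 0).1 k| + |(z' 0).2 k - (z 0).2 k|) + (1 + K * Θ k + 2 * γ) * ∫ s in (0:ℝ)..t', D k s := by
        linarith
    _ ≤ u k 0 + (1 + 2 * γ + K) * Θ k * ∫ s in (0:ℝ)..t', D k s := by
        refine add_le_add le_rfl (mul_le_mul_of_nonneg_right ?_ hI0)
        nlinarith [mul_nonneg (by positivity : (0:ℝ) ≤ 1 + 2 * γ) (sub_nonneg.2 hΘk)]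

end Flow

/-- **Registered helper `helper_kdVolterraLocal` (stub S, line `kick-dipole-no-collapse`): THE LOCAL VOLTERRA INEQUALITY OF
THE COMMON-NOISE FLIP** (closed form of the integral inequality of `volterra_local`).  For the flows of the pinned chain
(`ω₂ > 0`, `lam, β, γ ≥ 0`) from `x` and from `x^{i₀}` driven by the same continuous noise path, on `[0, t]` the site deviation
`u_k = |δq_k| + |δp_k|` satisfies `u_k(t') ≤ u_k(0) + C₁ Θ_k ∫₀^{t'} Σ_{|l−k|≤1} u_l` with `C₁ = 1 + 2γ + ω₂ + 2 lam + 8(1+2β)`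
and the LOCAL, time-independent weight `Θ_k = Σ_{|l−k|≤1} [1 + (2q_l² + 2t∫₀ᵗp_l²) + (2q_l² + 2t∫₀ᵗp'_l²)]`. -/
theorem helper_kdVolterraLocal : ∀ ω₂ lam β γ : ℝ, 0 < ω₂ → 0 ≤ lam → 0 ≤ β → 0 ≤ γ → ∀ (N : ℕ) (i₀ : Fin N) (x : PhaseSpace N) (η : ℝ → Fin N → ℝ), Continuous η → ∀ (t : ℝ), 0 ≤ t → ∀ k : Fin N, ∀ t' ∈ Set.Icc 0 t, |((pinnedChain ω₂ lam β γ).chainFlow N (momentumFlip i₀ x) η t').1 k - ((pinnedChain ω₂ lam β γ).chainFlow N x η t').1 k| + |((pinnedChain ω₂ lam β γ).chainFlow N (momentumFlip i₀ x) η t').2 k - ((pinnedChain ω₂ lam β γ).chainFlow N x η t').2 k| ≤ (|((pinnedChain ω₂ lam β γ).chainFlow N (momentumFlip i₀ x) η 0).1 k - ((pinnedChain ω₂ lam β γ).chainFlow N x η 0).1 k| + |((pinnedChain ω₂ lam β γ).chainFlow N (momentumFlip i₀ x) η 0).2 k - ((pinnedChain ω₂ lam β γ).chainFlow N x η 0).2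 k|) + ((1 + 2 * γ + (ω₂ + 2 * lam + 8 * (1 + 2 * β))) * ∑ l : Fin N, if l.val ≤ k.val + 1 ∧ k.val ≤ l.val + 1 then (1 + (2 * x.1 l ^ 2 + 2 * t * ∫ r in (0:ℝ)..t, ((pinnedChain ω₂ lam β γ).chainFlow N x η r).2 l ^ 2) + (2 * x.1 l ^ 2 + 2 * t * ∫ r in (0:ℝ)..t, ((pinnedChain ω₂ lam β γ).chainFlow N (momentumFlip i₀ x) η r).2 l ^ 2)) else 0) * ∫ s in (0:ℝ)..t', ∑ l : Fin N, if l.val ≤ k.val + 1 ∧ k.val ≤ l.val + 1 then (|((pinnedChain ω₂ lam β γ).chainFlow N (momentumFlip i₀ x) η s).1 l - ((pinnedChain ω₂ lam β γ).chainFlow N x η s).1 l| + |((pinnedChain ω₂ lam β γ).chainFlow N (momentumFlip i₀ x) η s).2 l - ((pinnedChain ω₂ lam β γ).chainFlow N x η s).2 l|) else 0 := by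
  intro ω₂ lam β γ hω hl hβ hγ N i₀ x η hη t ht k t' ht'
  exact (volterra_local hω hl hβ hγ N i₀ x hη ht).2.2.2.2 k t' ht'

end Summit.AtomisticToContinuum.FouriersLaw.Cruxes.ConductanceLowerBound.KickDipoleNoCollapse

end
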